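import Literature.Probability.ODonnellSaksSchrammServedio2005.StrategyTree
import HarnessLib

/-!
# Hutchcroft's ghost-field exploration: the decision forest of the volume differential inequality

Source: T. Hutchcroft, *New critical exponent inequalities for percolation and the random cluster model*,
Probab. Math. Phys. 1 (2020) 147–165, arXiv:1901.10363, §3, proof of Proposition 3.1: "let `η ∈ {0,1}^V`
be a random subset of `V` where vertices are included independently … we call vertices with `η(v) = 1`
green … `g(ω,η) = 1(η(u) = 1 for some u ∈ K_v(ω))` … `T^u` … first queries the status of `η(u)`, halts
if `η(u) = 0`, and otherwise explores the cluster of `u` in `ω` … an edge `e` is revealed by `F(ω,η)` if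
and only if the cluster of at least one endpoint of `e` contains a green vertex, [so]
`δ_e(F,μ) ≤ 2 sup_u P(η(K_u) ≥ 1)`."

This file formalises that decision forest as ONE legal query strategy (`Strategy`, `StrategyTree.lean`)
on the product cube `E ⊕ W → Bool` of a finite "graph with edge labels" — vertex type `W`, edge-label type
`E`, incidence `edge : W → W → Option E` (symmetric in the applications) — edge coordinates `inl e` (open /
closed) and ghost coordinates `inr u` (green / not): query every ghost coordinate; then, as long as some
unqueried edge has an endpoint joined by queried-open edges to a queried-green vertex, query it; halt.
Proved: legality (`strategy_legal`); HALTING CORRECTNESS (`label_eq_of_halt`): at a halting state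
consistent with the input the label `±1` according to "some queried-green vertex is joined to `v` by
queried-open edges" equals `2g_v − 1`; and the REVEALMENT property (`hasGreen_of_query`): an edge is
queried only when (in the full input) the cluster of one of its endpoints contains a green vertex, whence
`δ_{inl e} ≤ P(K_a ∋ green) + P(K_b ∋ green)` for the endpoints `a, b` of `e` (`revealment_edge_le`).
The covariance inequality itself (Prop 3.1) is assembled in `HutchcroftVolumeCovariance.lean`.
-/

namespace Literature.Probability.Percolation

open Finset Function Literature.Probability.ODonnellSaksSchrammServedio2005
open Literature.Probability.ODonnellSaksSchrammServedio2005.Strategy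

namespace GhostExploration

variable {W E : Type*} (edge : W → W → Option E)

/-- Open adjacency read from an EDGE configuration `y : E → Bool`: `a ≠ b` joined by an edge labelled `e`
with `y e = true`. [cite: Hutchcroft2020, §3 proof of Prop 3.1 (the cluster K_v(ω))] -/
def YAdj (y : E → Bool) (a b : W) : Prop := a ≠ b ∧ ∃ e, edge a b = some e ∧ y e = true

/-- Open connection `a ↔ b` in the edge configuration `y` (reflexive–transitive closure of `YAdj`).
[cite: Hutchcroft2020, §3 proof of Prop 3.1 (the cluster K_v(ω))] -/
def YReach (y : E → Bool) (a b : W) : Prop := Relation.ReflTransGen (YAdj edge y) a b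

/-- "The cluster of `a` contains a green vertex": some `u` with ghost bit `x (inr u) = true` is joined to
`a` by open edges of `x ∘ inl` — the event `{η(K_a) ≥ 1}`. [cite: Hutchcroft2020, §3 proof of Prop 3.1 (g = 1(η(u)=1 for some u ∈ K_v))] -/
def HasGreen (x : E ⊕ W → Bool) (a : W) : Prop :=
  ∃ u, x (Sum.inr u) = true ∧ YReach edge (fun e => x (Sum.inl e)) u a

/-- Queried-open adjacency of a PARTIAL assignment `σ`: an edge labelled `e` with `σ (inl e) = some true`.
[cite: Hutchcroft2020, §3 proof of Prop 3.1 (the sets U_n, O_n of the decision tree T^u)] -/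
def SAdj (σ : E ⊕ W → Option Bool) (a b : W) : Prop :=
  a ≠ b ∧ ∃ e, edge a b = some e ∧ σ (Sum.inl e) = some true

/-- Queried-open connection of a partial assignment. [cite: Hutchcroft2020, §3 proof of Prop 3.1 (the sets U_n, O_n)] -/
def SReach (σ : E ⊕ W → Option Bool) (a b : W) : Prop := Relation.ReflTransGen (SAdj edge σ) a b

/-- A vertex is ACTIVE at the partial assignment `σ` when it is joined by queried-open edges to a
queried-green vertex (it lies in the currently explored part of the cluster of a green vertex).
[cite: Hutchcroft2020, §3 proof of Prop 3.1 (the set U_n of T^u, u green)] -/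
def Active (σ : E ⊕ W → Option Bool) (a : W) : Prop := ∃ u, σ (Sum.inr u) = some true ∧ SReach edge σ u a

open Classical in
/-- THE GHOST-EXPLORATION STRATEGY (Hutchcroft's decision forest `F = {T^u}` serialised): query an
unqueried ghost coordinate if any; else query an unqueried edge with an active endpoint if any; else halt.
[cite: Hutchcroft2020, §3 proof of Prop 3.1 (the decision forest F = {T^u : u ∈ V})] -/
noncomputable def strategy (σ : E ⊕ W → Option Bool) : Option (E ⊕ W) :=
  if h : ∃ u, σ (Sum.inr u) = none then some (Sum.inr (Classical.choose h))
  else if h' : ∃ e, σ (Sum.inl e) = none ∧ ∃ a b, edge a b = some e ∧ Active edge σ a then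
    some (Sum.inl (Classical.choose h'))
  else none

open Classical in
/-- Leaf labels for the target vertex `v`: `+1` if some queried-green vertex is joined to `v` by
queried-open edges, `−1` otherwise (the `±1` form of `g`). [cite: Hutchcroft2020, §3 proof of Prop 3.1 (F computes g)] -/
noncomputable def label (v : W) (σ : E ⊕ W → Option Bool) : ℝ := if Active edge σ v then 1 else -1

open Classical in
/-- The `±1` form `2g_v − 1` of Hutchcroft's `g(ω,η) = 1(η(u) = 1 for some u ∈ K_v(ω))`.
[cite: Hutchcroft2020, §3 proof of Prop 3.1 (the function g)] -/
noncomputable def gpm (v : W) (x : E ⊕ W → Bool) : ℝ := if HasGreen edge x v then 1 else -1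

/-- `|2g − 1| ≤ 1`. [cite: Hutchcroft2020, §3 proof of Prop 3.1 (g is {0,1}-valued)] -/
theorem abs_gpm_le (v : W) (x : E ⊕ W → Bool) : |gpm edge v x| ≤ 1 := by
  unfold gpm; split_ifs <;> simp

/-- The ghost-exploration strategy is legal (queries only unqueried coordinates).
[cite: Hutchcroft2020, §3 proof of Prop 3.1 (T^u is a decision tree)] -/
theorem strategy_legal : Legal (strategy edge) := by
  intro σ i hi
  unfold strategy at hi
  split_ifs at hi with h h'
  · cases hi; exact Classical.choose_spec h
  · cases hi; exact (Classical.choose_spec h').1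

variable {edge}

/-- Queried-open connections of a state consistent with the input are open connections of the input.
[cite: Hutchcroft2020, §3 proof of Prop 3.1 (O_n ⊆ open edges)] -/
theorem yReach_of_sReach {σ : E ⊕ W → Option Bool} {x : E ⊕ W → Bool} (hc : Consistent σ x) {a b : W}
    (h : SReach edge σ a b) : YReach edge (fun e => x (Sum.inl e)) a b := by
  unfold SReach at h; unfold YReach
  refine Relation.ReflTransGen.mono (fun c d hcd => ?_) _ _ h
  obtain ⟨hne, e, he, hσ⟩ := hcd
  exact ⟨hne, e, he, hc _ _ hσ⟩

/-- An active vertex of a state consistent with the input has a green vertex in its cluster.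
[cite: Hutchcroft2020, §3 proof of Prop 3.1 (U_n ⊆ K_u, u green)] -/
theorem hasGreen_of_active {σ : E ⊕ W → Option Bool} {x : E ⊕ W → Bool} (hc : Consistent σ x) {a : W}
    (h : Active edge σ a) : HasGreen edge x a := by
  obtain ⟨u, hu, hr⟩ := h
  exact ⟨u, hc _ _ hu, yReach_of_sReach hc hr⟩

/-- At a state with no pending edge, an open path of the input from a queried-green vertex consists of
queried-open edges. [cite: Hutchcroft2020, §3 proof of Prop 3.1 (T^u halts when no edge touches U_n)] -/
theorem sReach_of_yReach_of_noPending {σ : E ⊕ W → Option Bool} {x : E ⊕ W → Bool} (hc : Consistent σ x)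
    (h' : ∀ e, σ (Sum.inl e) = none → ∀ a b, edge a b = some e → ¬Active edge σ a)
    {u : W} (hσu : σ (Sum.inr u) = some true) {w : W} (hr : YReach edge (fun e => x (Sum.inl e)) u w) :
    SReach edge σ u w := by
  unfold YReach at hr; unfold SReach
  induction hr with
  | refl => exact Relation.ReflTransGen.refl
  | tail _ hbc ih =>
    obtain ⟨hne, e, he, hxe⟩ := hbc
    have hact : Active edge σ _ := ⟨u, hσu, ih⟩
    have hq : σ (Sum.inl e) ≠ none := fun hnone => h' e hnone _ _ he hact
    have hσe : σ (Sum.inl e) = some true := by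
      cases hq' : σ (Sum.inl e) with
      | none => exact absurd hq' hq
      | some b' =>
        have hb : x (Sum.inl e) = b' := hc _ _ hq'
        have hb' : b' = true := by rw [← hb]; exact hxe
        rw [hb']
    exact Relation.ReflTransGen.tail ih ⟨hne, e, he, hσe⟩

/-- HALTING CORRECTNESS: at a halting state consistent with the input the label equals `2g_v − 1` —
"the decision forest `F` computes `g`". [cite: Hutchcroft2020, §3 proof of Prop 3.1 (F computes g)] -/
theorem label_eq_of_halt (v : W) (σ : E ⊕ W → Option Bool) (x : E ⊕ W → Bool) (hc : Consistent σ x)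
    (hh : strategy edge σ = none) : label edge v σ = gpm edge v x := by
  unfold strategy at hh
  split_ifs at hh with h h'
  simp only [not_exists, not_and] at h h'
  have key : Active edge σ v ↔ HasGreen edge x v := by
    refine ⟨hasGreen_of_active hc, fun hg => ?_⟩
    obtain ⟨u, hu, hr⟩ := hg
    -- the ghost bit of `u` is queried, hence queried-green
    have hσu : σ (Sum.inr u) = some true := by
      cases hq : σ (Sum.inr u) with
      | none => exact absurd hq (h u)
      | some b =>
        have hb : x (Sum.inr u) = b := hc _ _ hq
        have hb' : b = true := by rw [← hb]; exact hu
        rw [hb']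
    exact ⟨u, hσu, sReach_of_yReach_of_noPending hc h' hσu hr⟩
  unfold label gpm
  by_cases hA : Active edge σ v
  · rw [if_pos hA, if_pos (key.mp hA)]
  · rw [if_neg hA, if_neg (fun hG => hA (key.mpr hG))]

/-- REVEALMENT: an edge coordinate is queried only at a state where one endpoint of the edge is active,
hence (for the input) has a green vertex in its cluster — "an edge `e` is revealed by `F(ω,η)` if and
only if the cluster of at least one endpoint of `e` contains a green vertex".
[cite: Hutchcroft2020, §3 proof of Prop 3.1 (bound on δ_e(F, μ))] -/
theorem hasGreen_of_query {σ : E ⊕ W → Option Bool} {x : E ⊕ W → Bool} (hc : Consistent σ x) {e : E}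
    (hq : strategy edge σ = some (Sum.inl e)) : ∃ a b, edge a b = some e ∧ HasGreen edge x a := by
  unfold strategy at hq
  split_ifs at hq with h h'
  · cases hq
  · simp only [Option.some.injEq, Sum.inl.injEq] at hq
    obtain ⟨_, a, b, hab, hact⟩ := Classical.choose_spec h'
    rw [hq] at hab
    exact ⟨a, b, hab, hasGreen_of_active hc hact⟩

variable [Fintype W] [Fintype E] [DecidableEq W] [DecidableEq E]

open Classical in
/-- REVEALMENT BOUND: if every label is carried by at most the pair `{a₀, b₀}` (endpoint uniqueness, as
for the edges of a simple graph), then `δ_{inl e} ≤ P(K_{a₀} ∋ green) + P(K_{b₀} ∋ green)`.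
[cite: Hutchcroft2020, §3 proof of Prop 3.1 (δ_e(F,μ) ≤ 2 sup_u P(η(K_u) ≥ 1))] -/
theorem revealment_edge_le (p : E ⊕ W → ℝ) (h0 : ∀ i, 0 ≤ p i) (h1 : ∀ i, p i ≤ 1) (v : W) (e : E)
    (a₀ b₀ : W) (hends : ∀ a b, edge a b = some e → a = a₀ ∨ a = b₀) :
    revealment p (strategy edge) (label edge v) (Sum.inl e)
      ≤ (∑ x, wt p x * (if HasGreen edge x a₀ then 1 else 0))
        + ∑ x, wt p x * (if HasGreen edge x b₀ then 1 else 0) := by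
  have h := revealment_le h0 h1 (strategy edge) (label edge v) (Sum.inl e)
    (fun x => HasGreen edge x a₀ ∨ HasGreen edge x b₀) (fun σ x hc hq => by
      obtain ⟨a, b, hab, hg⟩ := hasGreen_of_query hc hq
      rcases hends a b hab with rfl | rfl
      · exact Or.inl hg
      · exact Or.inr hg)
  refine h.trans ?_
  rw [← Finset.sum_add_distrib]
  refine Finset.sum_le_sum fun x _ => ?_
  rw [← mul_add]
  refine mul_le_mul_of_nonneg_left ?_ (wt_nonneg h0 h1 x)
  by_cases ha : HasGreen edge x a₀ <;> by_cases hb : HasGreen edge x b₀ <;> simp [ha, hb]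

/-- An edge label carried by no pair is never queried: `δ_{inl e} = 0`-bound in the form `≤ 0`.
[cite: Hutchcroft2020, §3 proof of Prop 3.1 (bound on δ_e(F, μ))] -/
theorem revealment_edge_le_zero (p : E ⊕ W → ℝ) (h0 : ∀ i, 0 ≤ p i) (h1 : ∀ i, p i ≤ 1) (v : W)
    (e : E) (hno : ∀ a b, edge a b ≠ some e) :
    revealment p (strategy edge) (label edge v) (Sum.inl e) ≤ 0 := by
  have h := revealment_le h0 h1 (strategy edge) (label edge v) (Sum.inl e) (fun _ => False)
    (fun σ x hc hq => by
      obtain ⟨a, b, hab, _⟩ := hasGreen_of_query hc hq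
      exact hno a b hab)
  simpa using h

end GhostExploration

end Literature.Probability.Percolation
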